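import Literature.Algebra.EuclideanLattices.SmoothingGaussianMoments
import Mathlib.Probability.ProbabilityMassFunction.Integrals
import Mathlib.MeasureTheory.Integral.Lebesgue.Countable
import HarnessLib

/-!
# Expectations under `D_{Λ,s,c}` with unbounded integrands: MR07 Lemmas 4.2 and 4.3 as statements about `discreteGaussian`

Topic `Algebra/EuclideanLattices` (family `pqc`), sequel of `SmoothingGaussianMoments.lean`; serves the
decomposition of Micciancio–Regev 2007, Thm. 5.23
(`Literature.Computability.Cryptography.MicciancioRegev2007_gapCVP'_to_SIS'`). The prequels state MR07
Lemma 4.2 / 4.3 as quotients of lattice series; here they are restated as Bochner integrals against the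
probability measure of the tree's `discreteGaussian L s c : PMF L` (`DiscreteGaussian.lean`), which is the
form a probabilistic assembly consumes. The integrands `⟨x - c, u⟩`, `⟨x - c, u⟩²`, `‖x - c‖²` are
unbounded, so integrability is derived from the summability of `|g| ρ_s(· - c)` over the lattice
(`integrable_toMeasure_of_summable`, a general fact about PMFs on countable types). Everything is
PROVED; theorems only.

## Results (`0 < ε < 1`, `0 < s`, `2η_ε(L) ≤ s`, `c u ∈ V`, `D = D_{L,s,c}`)

* `integrable_toMeasure_of_summable` — for a PMF `p` on a countable measurable space with measurable
  singletons, `∑ₐ |f a| p(a) < ∞ ⇒ f` integrable for `p.toMeasure`.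
* `integral_discreteGaussian_eq_of_summable` — `E_D[g] = (∑_x ρ_s(x - c) g(x)) / ρ_{s,c}(L)` whenever
  `∑_x |g(x)| ρ_s(x - c) < ∞`.
* `abs_integral_discreteGaussian_inner_sub_le` — **MR07 Lemma 4.2 (i)**: `|E_D[⟨x - c, u⟩]| ≤ ε s ‖u‖/(1 - ε)`.
* `abs_integral_discreteGaussian_inner_sub_sq_sub_le` — **MR07 Lemma 4.2 (ii)**:
  `|E_D[⟨x - c, u⟩²] - s²‖u‖²/(2π)| ≤ ε s² ‖u‖²/(1 - ε)`.
* `integral_discreteGaussian_norm_sub_sq_le` — **MR07 Lemma 4.3 (ii)**: `E_D[‖x - c‖²] ≤ (1/(2π) + ε/(1-ε)) s² n`.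
* `integrable_discreteGaussian_coe_sub`, `norm_integral_discreteGaussian_coe_sub_sq_le` — **MR07 Lemma 4.3 (i)**:
  `x - c` is Bochner integrable under `D` and `‖E_D[x - c]‖² ≤ (ε/(1-ε))² s² n`.

## References

* D. Micciancio, O. Regev, *Worst-case to average-case reductions based on Gaussian measures*,
  SIAM J. Comput. 37 (2007) 267–302, Lemma 4.2, Lemma 4.3 (authors' version pp. 13–14).
-/

noncomputable section

open MeasureTheory Module Metric Filter Set
open scoped Real ENNReal InnerProductSpace Topology

namespace Literature.Algebra.EuclideanLattices

section PMF

variable {α : Type*} [MeasurableSpace α] [MeasurableSingletonClass α] [Countable α]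

/-- **Integrability under a probability mass function from absolute summability**: if
`∑ₐ |f(a)| p(a) < ∞` then `f` is integrable for the measure of `p`. [folklore] -/
theorem integrable_toMeasure_of_summable (p : PMF α) {f : α → ℝ}
    (h : Summable fun a ↦ |f a| * (p a).toReal) : Integrable f p.toMeasure := by
  refine ⟨(measurable_of_countable f).aestronglyMeasurable, ?_⟩
  rw [hasFiniteIntegral_iff_enorm, lintegral_countable']
  have hterm : ∀ a, ‖f a‖ₑ * p.toMeasure {a} = ENNReal.ofReal (|f a| * (p a).toReal) := fun a ↦ by
    rw [PMF.toMeasure_apply_singleton p a (MeasurableSet.singleton a), Real.enorm_eq_ofReal_abs,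
      ENNReal.ofReal_mul (abs_nonneg _), ENNReal.ofReal_toReal (p.apply_ne_top a)]
  simp_rw [hterm]
  rw [← ENNReal.ofReal_tsum_of_nonneg (fun a ↦ by positivity) h]
  exact ENNReal.ofReal_lt_top

end PMF

section Lattice

variable {V : Type*} [NormedAddCommGroup V] [InnerProductSpace ℝ V] [FiniteDimensional ℝ V]
  [MeasurableSpace V] [BorelSpace V]
variable (L : Submodule ℤ V) [DiscreteTopology L] [IsZLattice ℝ L]

/-- **Expectations under `D_{L,s,c}` for absolutely summable integrands**:
`E_{x∼D_{L,s,c}}[g(x)] = (∑_{x ∈ L} ρ_s(x - c) g(x)) / ρ_{s,c}(L)` whenever `∑_x |g(x)| ρ_s(x - c) < ∞`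
(`0 < s`). [cite: MicciancioRegev2007, §2 (eq. (6), p. 8)] -/
theorem integral_discreteGaussian_eq_of_summable {s : ℝ} (hs : 0 < s) (c : V) {g : L → ℝ}
    (hg : Summable fun x : L ↦ |g x| * gaussianFunction s ((x : V) - c)) :
    ∫ x, g x ∂(discreteGaussian L s c).toMeasure =
      (∑' x : L, gaussianFunction s ((x : V) - c) * g x) / ∑' x : L, gaussianFunction s ((x : V) - c) := by
  have hint : Integrable g (discreteGaussian L s c).toMeasure := by
    refine integrable_toMeasure_of_summable _ ?_
    simp_rw [discreteGaussian_toReal L hs c]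
    refine (hg.div_const (∑' y : L, gaussianFunction s ((y : V) - c))).congr fun x ↦ ?_
    ring
  rw [PMF.integral_eq_tsum _ g hint]
  simp_rw [discreteGaussian_toReal L hs c, smul_eq_mul, div_mul_eq_mul_div]
  rw [tsum_div_const]

omit [MeasurableSpace V] [BorelSpace V] in
/-- `∑_x |⟨x - c, u⟩| ρ_s(x - c) < ∞` (from `|a| ≤ 1 + a²` and the summability of `ρ` and `⟨·⟩²ρ`).
[folklore] -/
theorem summable_abs_inner_mul_gaussianFunction_sub {s : ℝ} (hs : 0 < s) (c u : V) :
    Summable fun x : L ↦ |⟪(x : V) - c, u⟫_ℝ| * gaussianFunction s ((x : V) - c) := by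
  have h1 := summable_gaussianFunction_sub L hs.ne' c
  have h2 := summable_inner_sq_mul_gaussianFunction_sub L hs c u
  refine Summable.of_nonneg_of_le (fun x ↦ mul_nonneg (abs_nonneg _) (gaussianFunction_pos _ _).le)
    (fun x ↦ ?_) (h1.add h2)
  have hρ := (gaussianFunction_pos s ((x : V) - c)).le
  have hab : |⟪(x : V) - c, u⟫_ℝ| ≤ 1 + ⟪(x : V) - c, u⟫_ℝ ^ 2 := by
    nlinarith [abs_nonneg ⟪(x : V) - c, u⟫_ℝ, sq_abs ⟪(x : V) - c, u⟫_ℝ,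
      sq_nonneg (|⟪(x : V) - c, u⟫_ℝ| - 1)]
  calc |⟪(x : V) - c, u⟫_ℝ| * gaussianFunction s ((x : V) - c)
      ≤ (1 + ⟪(x : V) - c, u⟫_ℝ ^ 2) * gaussianFunction s ((x : V) - c) := mul_le_mul_of_nonneg_right hab hρ
    _ = gaussianFunction s ((x : V) - c) + ⟪(x : V) - c, u⟫_ℝ ^ 2 * gaussianFunction s ((x : V) - c) := by ring

omit [MeasurableSpace V] [BorelSpace V] in
/-- `∑_x ‖x - c‖² ρ_s(x - c) < ∞` (expand in an orthonormal basis). [folklore] -/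
theorem summable_norm_sq_mul_gaussianFunction_sub {s : ℝ} (hs : 0 < s) (c : V) :
    Summable fun x : L ↦ ‖(x : V) - c‖ ^ 2 * gaussianFunction s ((x : V) - c) := by
  set b : OrthonormalBasis (Fin (finrank ℝ V)) ℝ V := stdOrthonormalBasis ℝ V with hb
  have h : Summable fun x : L ↦ ∑ i, ⟪(x : V) - c, b i⟫_ℝ ^ 2 * gaussianFunction s ((x : V) - c) :=
    summable_sum fun i _ ↦ summable_inner_sq_mul_gaussianFunction_sub L hs c (b i)
  refine h.congr fun x ↦ ?_
  rw [← Finset.sum_mul, b.sum_sq_inner_left]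

/-- **Micciancio–Regev 2007, Lemma 4.2 (i), expectation form**: for `0 < ε < 1`, `0 < s`,
`2η_ε(L) ≤ s`, centre `c` and direction `u`, `|E_{x∼D_{L,s,c}}[⟨x - c, u⟩]| ≤ ε s ‖u‖/(1 - ε)`.
[cite: MicciancioRegev2007, Lemma 4.2] -/
theorem abs_integral_discreteGaussian_inner_sub_le {ε s : ℝ} (hε : 0 < ε) (hε1 : ε < 1) (hs : 0 < s)
    (hηs : 2 * smoothingParameter L ε ≤ s) (c u : V) :
    |∫ x, ⟪(x : V) - c, u⟫_ℝ ∂(discreteGaussian L s c).toMeasure| ≤ ε * s * ‖u‖ / (1 - ε) := by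
  rw [integral_discreteGaussian_eq_of_summable L hs c (summable_abs_inner_mul_gaussianFunction_sub L hs c u)]
  have hZ : 0 < ∑' x : L, gaussianFunction s ((x : V) - c) := tsum_gaussianFunction_sub_pos L hs.ne' c
  have h := abs_tsum_inner_mul_gaussianFunction_sub_div_le L hε hε1 hs hηs c u
  rw [abs_div, abs_of_pos hZ]
  have heq : ∑' x : L, gaussianFunction s ((x : V) - c) * ⟪(x : V) - c, u⟫_ℝ =
      ∑' x : L, ⟪(x : V) - c, u⟫_ℝ * gaussianFunction s ((x : V) - c) := tsum_congr fun x ↦ mul_comm _ _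
  rwa [heq]

/-- **Micciancio–Regev 2007, Lemma 4.2 (ii), expectation form**: for `0 < ε < 1`, `0 < s`,
`2η_ε(L) ≤ s`, centre `c` and direction `u`,
`|E_{x∼D_{L,s,c}}[⟨x - c, u⟩²] - s²‖u‖²/(2π)| ≤ ε s² ‖u‖²/(1 - ε)`. [cite: MicciancioRegev2007, Lemma 4.2] -/
theorem abs_integral_discreteGaussian_inner_sub_sq_sub_le {ε s : ℝ} (hε : 0 < ε) (hε1 : ε < 1) (hs : 0 < s)
    (hηs : 2 * smoothingParameter L ε ≤ s) (c u : V) :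
    |∫ x, ⟪(x : V) - c, u⟫_ℝ ^ 2 ∂(discreteGaussian L s c).toMeasure - s ^ 2 * ‖u‖ ^ 2 / (2 * π)| ≤
      ε * s ^ 2 * ‖u‖ ^ 2 / (1 - ε) := by
  have hsum : Summable fun x : L ↦ |⟪(x : V) - c, u⟫_ℝ ^ 2| * gaussianFunction s ((x : V) - c) :=
    (summable_inner_sq_mul_gaussianFunction_sub L hs c u).congr fun x ↦ by rw [abs_of_nonneg (sq_nonneg _)]
  rw [integral_discreteGaussian_eq_of_summable L hs c hsum]
  have h := abs_tsum_inner_sq_mul_gaussianFunction_sub_div_sub_le L hε hε1 hs hηs c u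
  have heq : ∑' x : L, gaussianFunction s ((x : V) - c) * ⟪(x : V) - c, u⟫_ℝ ^ 2 =
      ∑' x : L, ⟪(x : V) - c, u⟫_ℝ ^ 2 * gaussianFunction s ((x : V) - c) := tsum_congr fun x ↦ mul_comm _ _
  rwa [heq]

/-- **Micciancio–Regev 2007, Lemma 4.3 (ii), expectation form**: for `0 < ε < 1`, `0 < s`,
`2η_ε(L) ≤ s` and centre `c`, `E_{x∼D_{L,s,c}}[‖x - c‖²] ≤ (1/(2π) + ε/(1-ε)) s² n`.
[cite: MicciancioRegev2007, Lemma 4.3] -/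
theorem integral_discreteGaussian_norm_sub_sq_le {ε s : ℝ} (hε : 0 < ε) (hε1 : ε < 1) (hs : 0 < s)
    (hηs : 2 * smoothingParameter L ε ≤ s) (c : V) :
    ∫ x, ‖(x : V) - c‖ ^ 2 ∂(discreteGaussian L s c).toMeasure ≤
      (1 / (2 * π) + ε / (1 - ε)) * s ^ 2 * finrank ℝ V := by
  have hsum : Summable fun x : L ↦ |‖(x : V) - c‖ ^ 2| * gaussianFunction s ((x : V) - c) :=
    (summable_norm_sq_mul_gaussianFunction_sub L hs c).congr fun x ↦ by rw [abs_of_nonneg (sq_nonneg _)]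
  rw [integral_discreteGaussian_eq_of_summable L hs c hsum]
  have h := tsum_norm_sq_mul_gaussianFunction_sub_div_le L hε hε1 hs hηs c
  have heq : ∑' x : L, gaussianFunction s ((x : V) - c) * ‖(x : V) - c‖ ^ 2 =
      ∑' x : L, ‖(x : V) - c‖ ^ 2 * gaussianFunction s ((x : V) - c) := tsum_congr fun x ↦ mul_comm _ _
  rwa [heq]

/-- `x ↦ x - c` is Bochner integrable under `D_{L,s,c}` (`0 < s`): its norm is dominated by
`1 + ‖x - c‖²`, whose Gaussian series converges. [cite: MicciancioRegev2007, §2 (eq. (6), p. 8)] -/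
theorem integrable_discreteGaussian_coe_sub {s : ℝ} (hs : 0 < s) (c : V) :
    Integrable (fun x : L ↦ (x : V) - c) (discreteGaussian L s c).toMeasure := by
  have hnorm : Integrable (fun x : L ↦ ‖(x : V) - c‖) (discreteGaussian L s c).toMeasure := by
    refine integrable_toMeasure_of_summable _ ?_
    simp_rw [discreteGaussian_toReal L hs c]
    have h1 := summable_gaussianFunction_sub L hs.ne' c
    have h2 := summable_norm_sq_mul_gaussianFunction_sub L hs c
    have h3 : Summable fun x : L ↦ |‖(x : V) - c‖| * gaussianFunction s ((x : V) - c) := by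
      refine Summable.of_nonneg_of_le (fun x ↦ mul_nonneg (abs_nonneg _) (gaussianFunction_pos _ _).le)
        (fun x ↦ ?_) (h1.add h2)
      rw [abs_of_nonneg (norm_nonneg _)]
      have hρ := (gaussianFunction_pos s ((x : V) - c)).le
      have hab : ‖(x : V) - c‖ ≤ 1 + ‖(x : V) - c‖ ^ 2 := by
        nlinarith [norm_nonneg ((x : V) - c), sq_nonneg (‖(x : V) - c‖ - 1)]
      calc ‖(x : V) - c‖ * gaussianFunction s ((x : V) - c)
          ≤ (1 + ‖(x : V) - c‖ ^ 2) * gaussianFunction s ((x : V) - c) := mul_le_mul_of_nonneg_right hab hρ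
        _ = gaussianFunction s ((x : V) - c) + ‖(x : V) - c‖ ^ 2 * gaussianFunction s ((x : V) - c) := by ring
    refine (h3.div_const (∑' y : L, gaussianFunction s ((y : V) - c))).congr fun x ↦ ?_
    ring
  exact (integrable_norm_iff (measurable_of_countable _).aestronglyMeasurable).1 hnorm

/-- **Micciancio–Regev 2007, Lemma 4.3 (i), expectation form**: for `0 < ε < 1`, `0 < s`,
`2η_ε(L) ≤ s` and centre `c`, `‖E_{x∼D_{L,s,c}}[x - c]‖² ≤ (ε/(1-ε))² s² n` (proof as printed, p. 14:
expand `‖E[x - c]‖²` in an orthonormal basis `u₁, …, uₙ` and apply Lemma 4.2 (i) to each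
`⟨E[x - c], uᵢ⟩ = E[⟨x - c, uᵢ⟩]`). [cite: MicciancioRegev2007, Lemma 4.3] -/
theorem norm_integral_discreteGaussian_coe_sub_sq_le {ε s : ℝ} (hε : 0 < ε) (hε1 : ε < 1) (hs : 0 < s)
    (hηs : 2 * smoothingParameter L ε ≤ s) (c : V) :
    ‖∫ x, ((x : V) - c) ∂(discreteGaussian L s c).toMeasure‖ ^ 2 ≤
      (ε / (1 - ε)) ^ 2 * s ^ 2 * finrank ℝ V := by
  set μ := (discreteGaussian L s c).toMeasure with hμ
  set m : V := ∫ x, ((x : V) - c) ∂μ with hm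
  set b : OrthonormalBasis (Fin (finrank ℝ V)) ℝ V := stdOrthonormalBasis ℝ V with hb
  have hint := integrable_discreteGaussian_coe_sub L hs c
  -- each coordinate of `m` is the expectation of the corresponding coordinate
  have hcoord : ∀ i, ⟪m, b i⟫_ℝ = ∫ x, ⟪(x : V) - c, b i⟫_ℝ ∂μ := by
    intro i
    rw [hm, real_inner_comm, ← integral_inner hint (b i)]
    exact integral_congr_ae (Filter.Eventually.of_forall fun x ↦ real_inner_comm _ _)
  have hbound : ∀ i, ⟪m, b i⟫_ℝ ^ 2 ≤ (ε * s / (1 - ε)) ^ 2 := by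
    intro i
    have h := abs_integral_discreteGaussian_inner_sub_le L hε hε1 hs hηs c (b i)
    rw [b.norm_eq_one i, mul_one, ← hcoord i] at h
    exact sq_le_sq' (by linarith [(abs_le.1 h).1]) (abs_le.1 h).2
  calc ‖m‖ ^ 2 = ∑ i, ⟪m, b i⟫_ℝ ^ 2 := (b.sum_sq_inner_left m).symm
    _ ≤ ∑ _i : Fin (finrank ℝ V), (ε * s / (1 - ε)) ^ 2 := Finset.sum_le_sum fun i _ ↦ hbound i
    _ = (ε / (1 - ε)) ^ 2 * s ^ 2 * finrank ℝ V := by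
        rw [Finset.sum_const, Finset.card_univ, Fintype.card_fin, nsmul_eq_mul]
        ring

end Lattice

end Literature.Algebra.EuclideanLattices

end
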